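import Mathlib
import Literature.Claims.NS.Vukolov2026
import Literature.Analysis.FluidPDE.AxisymHouLiVariables
import HarnessLib

/-!
# StepC23RankLeTwo

Topic `Literature/Uncategorized`. Named literature fact(s) relocated by the gate from `Summits/NavierStokesRegularity/NavierStokesRegularity/Theorems/SoloRefuteVukolov2026.lean`
(accept-time relocation of `[cite]`d propositions written inline in a Summits proposal; human ruling 2026-08-15).
Sources: Vukolov2026.

* `Literature.Uncategorized.Step_C23_rankLeTwo`
-/

namespace Literature.Uncategorized

open Set Function Module Filter
open scoped ContDiff Topology
open Literature.Analysis Literature.Analysis.FluidPDE Literature.Claims.NS.ClayVariants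
open Literature.Claims.NS.Vukolov2026

/-- **Cor 2.3 with Theorem 2.1's hypothesis restored** (REFUTER-TYPED charitable variant, not a 2-READ
declaration): the same statement on fields with `rank ∇V ≤ 2` (= `det ∇V ≡ 0`) everywhere.
[cite: Vukolov2026, Thm 2.1 p.10 l.31–34; Cor 2.3 p.10 l.44–46] -/
def Step_C23_rankLeTwo : Prop :=
  ∀ V : E3 → E3, IsDatum V → (∀ x, jacRank V x ≤ 2) → ¬ IsRank1Form V → ¬ IsConst V → IsRank2 V

end Literature.Uncategorized
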